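import Literature.NumberTheory.DiophantineGeometry.FaltingsHeight
import Literature.NumberTheory.DiophantineGeometry.Conductor
import Literature.NumberTheory.DiophantineGeometry.LocalReduction
import Mathlib.NumberTheory.NumberField.InfinitePlace.TotallyRealComplex
import HarnessLib

/-!
# Unconditional exponential Szpiro-type bounds over totally real fields via Shimura curves
# (Pasten 2024, Thm 18.14 = Thm 1.19)

Topic `Literature/NumberTheory/EllipticCurves` (family `abc`, LADDER-ABC A1: the *modular method*
beyond `ℚ`). H. Pasten, *Shimura curves and the abc conjecture*, J. Number Theory **254** (2024)
214–335 = arXiv:1705.09251 [`PastenShimura2024`] (held TeX text; §1.5 pp. 9–10 and §18.5–18.7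
pp. 56–59 of the arXiv version read; arXiv numbering):

> **Theorem 18.14** (= Thm 1.19 of the introduction). *Let `F` be a totally real number field and let
> `ε > 0`. For all semi-stable elliptic curves `E` over `F` satisfying that the number of places of bad
> reduction of `E` has opposite parity to `[F:ℚ]`, we have `log δ_E ≪_{F,ε} N_E^{1+ε}`, hence
> `h(E) ≪_{F,ε} N_E^{1+ε}` and `log Δ_E ≪_{F,ε} N_E^{1+ε}`.*

Here (§1.5) `𝔑_E` is the conductor ideal, `N_E` its norm, `Δ_E` the norm of the (minimal)
discriminant ideal, `h(E)` the Faltings height of §18.1 (the height over `F`; `E` is semistable, so it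
is also the stable height), and `δ_E` the degree invariant of the Shimura-curve parametrisation
`X → E` attached to the quaternion algebra of discriminant `𝔑_E` (Thms 18.6, 18.10–18.13). Proof in
print (§18.7): the totally real analogue of the spectral bound Thm 5.5/7.2 with effective
multiplicity one on `GL₂` (the references [Brumley], [LiWa], [YWang] cited there), Shimizu's volume formula, the
Arakelov/Heegner-point height bound Thm 18.10, and modularity of elliptic curves over totally real
fields up to finitely many `j`-invariants (Freitas–Le Hung–Siksek, Thm 5) — "Note that here we do
not need to assume modularity".

## Contents

* `PastenShimura2024_thm_18_14` — the two displayed consequences (`h(E)` and `log Δ_E`), as a named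
  fact (`def … : Prop`, D-0014). The clause `log δ_E ≪ N_E^{1+ε}` itself is NOT recorded: the
  Shimura-curve degree `δ_E` over `F` (§18.3, Thms 18.6–18.7) has no carrier in the tree
  (`-- TODO(general form)`); likewise Thm 18.10 / Thm 1.17 (`h(E) ≤ ½ log deg ψ + c(n) log(d_F N(𝔑))`)
  and the conditional Thm 18.? / Thm 1.18 (real quadratic fields under Conj. `ConjModDegTR`) are not
  recorded.

Rendering: `F` a totally real number field (`NumberField F`, `NumberField.IsTotallyReal F`);
`E/F` is `W : WeierstrassCurve F` with `[W.IsElliptic]`; semistable = `W.IsSemistable (𝓞 F)`; the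
places of bad reduction are `W.badPlaces (𝓞 F)` (finite places without good reduction; a finite set
for elliptic `W`, `WeierstrassCurve.finite_badPlaces`), counted with `Set.ncard`; "opposite parity to
`[F:ℚ]`" = `Odd (#bad + [F:ℚ])`; `N_E = W.conductorNorm (𝓞 F)`, `Δ_E = W.minimalDiscriminantNorm (𝓞 F)`,
`h(E) = W.faltingsHeight`; "`≪_{F,ε}`" = one constant `C = C(F, ε)` for both displays (equivalent to
two); real exponent via `Real.rpow`.

## References

* [PastenShimura2024] H. Pasten, J. Number Theory 254 (2024) = arXiv:1705.09251: §1.5 Thms 1.17–1.19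
  (pp. 9–10), §18.1 (Faltings height over number fields, Lemma 18.1), §18.5 Thm 18.10, §18.6
  Thms 18.11–18.13, §18.7 Thm 18.14 (p. 59).
* [FLS] N. Freitas, B. Le Hung, S. Siksek, *Elliptic curves over real quadratic fields are modular*,
  Invent. Math. 201 (2015), Thm 5 (as cited there).
-/

noncomputable section

open WeierstrassCurve NumberField

namespace Literature.NumberTheory.EllipticCurves

/-- **Pasten 2024, Theorem 18.14 (= Thm 1.19): unconditional exponential bounds over totally real
fields.** For a totally real number field `F` and `ε > 0` there is `C = C(F, ε)` such that every
semistable elliptic curve `E/F` whose number of places of bad reduction has parity opposite to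
`[F:ℚ]` satisfies `h(E) ≤ C · N_E^{1+ε}` and `log Δ_E ≤ C · N_E^{1+ε}` (printed: "`≪_{F,ε}`"; the
intermediate clause `log δ_E ≪_{F,ε} N_E^{1+ε}` on the Shimura-curve degree is not recorded — no
carrier for `δ_E` in the tree). Proof in print: Shimura-curve parametrisations over `F`, effective
multiplicity one for `GL₂`, Heegner-point Arakelov heights (Yuan–Zhang), modularity over totally real
fields up to finitely many `j`-invariants (FLS). Named fact (D-0014).
[cite: PastenShimura2024, Thm 18.14 (arXiv numbering, §18.7 p. 59) = Thm 1.19] -/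
def PastenShimura2024_thm_18_14 : Prop :=
  ∀ (F : Type) [Field F] [NumberField F] [IsTotallyReal F] (ε : ℝ), 0 < ε → ∃ C : ℝ,
    ∀ (W : WeierstrassCurve F) [W.IsElliptic], W.IsSemistable (𝓞 F) →
      Odd ((W.badPlaces (𝓞 F)).ncard + Module.finrank ℚ F) →
        W.faltingsHeight ≤ C * (W.conductorNorm (𝓞 F) : ℝ) ^ (1 + ε) ∧
          Real.log (W.minimalDiscriminantNorm (𝓞 F)) ≤ C * (W.conductorNorm (𝓞 F) : ℝ) ^ (1 + ε)

/-- Reading of the parity hypothesis: an ODD number of bad places when `[F:ℚ]` is even (e.g. over a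
real quadratic field), an EVEN number when `[F:ℚ]` is odd (sanity lemma, unfolding `Odd (n + d)`).
[cite: PastenShimura2024, Thm 18.14 (parity hypothesis)] -/
theorem PastenShimura2024_thm_18_14.parity_iff {n d : ℕ} :
    Odd (n + d) ↔ (Odd n ↔ Even d) := by
  rw [Nat.odd_add]

end Literature.NumberTheory.EllipticCurves

end
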